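import Mathlib
import HarnessLib
import Literature.Analysis.Calculus.ThirdOrderChainRule
import Literature.Analysis.Calculus.IteratedDifferenceBound

/-!
# The INCREMENT `g∘(u+w) − g∘u` of a composite along a real line, for an ARBITRARY outer function with bounded jets:
# its chain of derivatives to order three and its first, second and third differences — every term carries the piece `w`
# or one of its derivatives

Topic `Literature/Analysis/Calculus`; the generic form of `MathematicalPhysics/QuantumLattice/HubbardSliceSymbolBandIncrementChain{,Low}`
(there the outer function is the slice-propagator symbol `Ψ̂`).  For `g : ℝ → ℂ` with derivatives `g₁, g₂, g₃` everywhere,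
`‖g_k‖ ≤ C_k` and increments `‖g_k(x+y) − g_k(x)‖ ≤ C_{k+1}|y|` (`k = 0, …, 3`, e.g. from a bound on the next derivative:
`norm_incr_le_of_hasDerivAt`), and two real curves `u`, `w` along a line with `|u_i| ≤ D_i`, `|w| ≤ W₀`, `|w_i| ≤ W_i`, the increment
`t ↦ g(u t + w t) − g(u t)` heads the DIFFERENCE of the two order-three chains of `hasDerivAt_chain3_comp`; its members are bounded by
explicit polynomials in which every monomial carries a factor `W₀, W₁, W₂` or `W₃` — the smallness of the piece `w` at its own scale —
and so are its iterated forward differences (`norm_fwdDiff_iter_le_of_hasDerivAt`).  In the renormalisation-group telescoping of a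
sector multiplier or of a propagator symbol over the pieces of a framed band (Benfatto–Giuliani–Mastropietro 2006, §3 (3.2)–(3.8)) `g` is the
radial cutoff profile or the slice symbol, `u` the partial band read along a grid line and `w = −Kₘ` the `m`-th piece.

* `norm_incr_le_of_hasDerivAt` — `‖f(x+y) − f(x)‖ ≤ C|y|` from `HasDerivAt f (f′ x) x`, `‖f′‖ ≤ C` (mean value inequality);
* `hasDerivAt_comp_incr_chain` — the chain `H 0 … H 3` of the increment and its `HasDerivAt` links;
* `norm_comp_incr_le`, `norm_comp_incr_deriv1_le`, `norm_comp_incr_deriv2_le`, `norm_comp_incr_deriv3_le` — pointwise bounds of `H 0 … H 3`: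
  `C₁W₀`; `C₂W₀(D₁+W₁) + C₁W₁`; `C₃W₀(D₁+W₁)² + C₂W₁(2D₁+W₁) + C₂W₀(D₂+W₂) + C₁W₂`;
  `C₄W₀(D₁+W₁)³ + C₃W₁(3D₁²+3D₁W₁+W₁²) + 3(C₃W₀(D₁+W₁)(D₂+W₂) + C₂(D₁W₂+W₁D₂+W₁W₂)) + C₂W₀(D₃+W₃) + C₁W₃`;
* `norm_fwdDiff_comp_incr_le`, `norm_fwdDiff_iter_two_comp_incr_le`, `norm_fwdDiff_iter_three_comp_incr_le` — the same bounds times `δ`, `δ²`, `δ³`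
  for the forward differences of step `δ ≥ 0` along the line.

Everything is proved; no definitions; no named facts. [folklore]

## Sources

G. Benfatto, A. Giuliani, V. Mastropietro, Ann. Henri Poincaré 7 (2006) 809–898, (2.36aa), §3 (3.2)–(3.8) (`BenfattoGiulianiMastropietro2006`).
Routine calculus ("folklore").
-/

noncomputable section

namespace Literature.Analysis.Calculus

open Set Complex

/-! ### §0 Increments from derivative bounds -/

/-- **Mean value inequality on the line**: if `HasDerivAt f (f′ x) x` everywhere and `‖f′‖ ≤ C`, then `‖f(x+y) − f(x)‖ ≤ C|y|`. [cite: BenfattoGiulianiMastropietro2006, §3 (3.2)] -/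
theorem norm_incr_le_of_hasDerivAt {E : Type*} [NormedAddCommGroup E] [NormedSpace ℝ E] {f f' : ℝ → E} {C : ℝ}
    (hf : ∀ x, HasDerivAt f (f' x) x) (hC : ∀ x, ‖f' x‖ ≤ C) (x y : ℝ) : ‖f (x + y) - f x‖ ≤ C * |y| := by
  have h := Convex.norm_image_sub_le_of_norm_hasDerivWithin_le (s := univ) (f := f) (f' := f') (C := C)
    (fun z _ => (hf z).hasDerivWithinAt) (fun z _ => hC z) convex_univ (mem_univ x) (mem_univ (x + y))
  simpa [Real.norm_eq_abs] using h

/-! ### §1 The chain of the increment -/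

section Chain

variable {g g₁ g₂ g₃ : ℝ → ℂ} {C₁ C₂ C₃ C₄ : ℝ}

/-- **The order-three chain of the increment `g∘(u+w) − g∘u`**: with `G[v]` the chain of `hasDerivAt_chain3_comp` for the curve `v`
(`v = u + w` with derivatives `u_i + w_i`, and `v = u`), the differences `H k = G[u+w] k − G[u] k` satisfy `HasDerivAt (H k) (H (k+1) t) t`
for `k < 3`. [cite: BenfattoGiulianiMastropietro2006, §3 (3.2)] -/
theorem hasDerivAt_comp_incr_chain (hg : ∀ x, HasDerivAt g (g₁ x) x) (hg₁ : ∀ x, HasDerivAt g₁ (g₂ x) x) (hg₂ : ∀ x, HasDerivAt g₂ (g₃ x) x)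
    {u u₁ u₂ u₃ w w₁ w₂ w₃ : ℝ → ℝ}
    (hu : ∀ t, HasDerivAt u (u₁ t) t) (hu₁ : ∀ t, HasDerivAt u₁ (u₂ t) t) (hu₂ : ∀ t, HasDerivAt u₂ (u₃ t) t)
    (hw : ∀ t, HasDerivAt w (w₁ t) t) (hw₁ : ∀ t, HasDerivAt w₁ (w₂ t) t) (hw₂ : ∀ t, HasDerivAt w₂ (w₃ t) t) :
    let H : ℕ → ℝ → ℂ := fun k t =>
      if k = 0 then g (u t + w t) - g (u t)
      else if k = 1 then g₁ (u t + w t) * ((u₁ t + w₁ t : ℝ) : ℂ) - g₁ (u t) * (u₁ t : ℂ)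
      else if k = 2 then (g₂ (u t + w t) * ((u₁ t + w₁ t : ℝ) : ℂ) ^ 2 + g₁ (u t + w t) * ((u₂ t + w₂ t : ℝ) : ℂ)) -
        (g₂ (u t) * (u₁ t : ℂ) ^ 2 + g₁ (u t) * (u₂ t : ℂ))
      else if k = 3 then (g₃ (u t + w t) * ((u₁ t + w₁ t : ℝ) : ℂ) ^ 3 + 3 * (g₂ (u t + w t) * ((u₁ t + w₁ t : ℝ) : ℂ) *
          ((u₂ t + w₂ t : ℝ) : ℂ)) + g₁ (u t + w t) * ((u₃ t + w₃ t : ℝ) : ℂ)) -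
        (g₃ (u t) * (u₁ t : ℂ) ^ 3 + 3 * (g₂ (u t) * (u₁ t : ℂ) * (u₂ t : ℂ)) + g₁ (u t) * (u₃ t : ℂ))
      else 0
    ∀ k < 3, ∀ t, HasDerivAt (H k) (H (k + 1) t) t := by
  intro H k hk t
  have hv : ∀ s, HasDerivAt (fun s => u s + w s) (u₁ s + w₁ s) s := fun s => (hu s).add (hw s)
  have hv₁ : ∀ s, HasDerivAt (fun s => u₁ s + w₁ s) (u₂ s + w₂ s) s := fun s => (hu₁ s).add (hw₁ s)
  have hv₂ : ∀ s, HasDerivAt (fun s => u₂ s + w₂ s) (u₃ s + w₃ s) s := fun s => (hu₂ s).add (hw₂ s)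
  have hA := hasDerivAt_chain3_comp (g := g) (g₁ := g₁) (g₂ := g₂) (g₃ := g₃) hg hg₁ hg₂ hv hv₁ hv₂
  have hB := hasDerivAt_chain3_comp (g := g) (g₁ := g₁) (g₂ := g₂) (g₃ := g₃) hg hg₁ hg₂ hu hu₁ hu₂
  interval_cases k
  · exact ((hA 0 (by norm_num) t).sub (hB 0 (by norm_num) t))
  · exact ((hA 1 (by norm_num) t).sub (hB 1 (by norm_num) t))
  · exact ((hA 2 (by norm_num) t).sub (hB 2 (by norm_num) t))

/-! ### §2 Pointwise bounds of the members `H 0, …, H 3` -/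

/-- **Order zero**: `‖g(x+y) − g(x)‖ ≤ C₁W₀` for `|y| ≤ W₀` (`‖g(x+y) − g(x)‖ ≤ C₁|y|`). [cite: BenfattoGiulianiMastropietro2006, §3 (3.2)] -/
theorem norm_comp_incr_le (i₀ : ∀ x y, ‖g (x + y) - g x‖ ≤ C₁ * |y|) {x y W₀ : ℝ} (hy : |y| ≤ W₀) : ‖g (x + y) - g x‖ ≤ C₁ * W₀ := by
  have hC₁ : 0 ≤ C₁ := by
    have h := i₀ 0 1
    have : (0 : ℝ) ≤ C₁ * |(1:ℝ)| := (norm_nonneg _).trans h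
    simpa using this
  exact (i₀ x y).trans (mul_le_mul_of_nonneg_left hy hC₁)

/-- **Order one**: `‖g₁(x+y)·(a+a′) − g₁(x)·a‖ ≤ C₂W₀(D₁+W₁) + C₁W₁` (`|a| ≤ D₁`, `|y| ≤ W₀`, `|a′| ≤ W₁`). [cite: BenfattoGiulianiMastropietro2006, §3 (3.2)] -/
theorem norm_comp_incr_deriv1_le (h₁ : ∀ x, ‖g₁ x‖ ≤ C₁) (i₁ : ∀ x y, ‖g₁ (x + y) - g₁ x‖ ≤ C₂ * |y|)
    {x y a a' : ℝ} {D₁ W₀ W₁ : ℝ} (ha : |a| ≤ D₁) (hy : |y| ≤ W₀) (ha' : |a'| ≤ W₁) :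
    ‖g₁ (x + y) * ((a + a' : ℝ) : ℂ) - g₁ x * (a : ℂ)‖ ≤ C₂ * W₀ * (D₁ + W₁) + C₁ * W₁ := by
  have hC₁ : 0 ≤ C₁ := (norm_nonneg _).trans (h₁ 0)
  have hC₂ : 0 ≤ C₂ := by
    have h := i₁ 0 1
    have : (0 : ℝ) ≤ C₂ * |(1:ℝ)| := (norm_nonneg _).trans h
    simpa using this
  have hW0 : 0 ≤ W₀ := (abs_nonneg _).trans hy
  have key : g₁ (x + y) * ((a + a' : ℝ) : ℂ) - g₁ x * (a : ℂ) =
      (g₁ (x + y) - g₁ x) * ((a + a' : ℝ) : ℂ) + g₁ x * ((a' : ℝ) : ℂ) := by push_cast; ring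
  rw [key]
  have t1 : ‖(g₁ (x + y) - g₁ x) * ((a + a' : ℝ) : ℂ)‖ ≤ C₂ * W₀ * (D₁ + W₁) := by
    rw [norm_mul, Complex.norm_real, Real.norm_eq_abs]
    exact mul_le_mul ((i₁ x y).trans (mul_le_mul_of_nonneg_left hy hC₂)) ((abs_add_le _ _).trans (add_le_add ha ha')) (abs_nonneg _)
      (by positivity)
  have t2 : ‖g₁ x * ((a' : ℝ) : ℂ)‖ ≤ C₁ * W₁ := by
    rw [norm_mul, Complex.norm_real, Real.norm_eq_abs]
    exact mul_le_mul (h₁ x) ha' (abs_nonneg _) hC₁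
  exact (norm_add_le _ _).trans (add_le_add t1 t2)

/-- **Order two**: `‖[g₂(x+y)(a+a′)² + g₁(x+y)(b+b′)] − [g₂(x)a² + g₁(x)b]‖ ≤ C₃W₀(D₁+W₁)² + C₂W₁(2D₁+W₁) + C₂W₀(D₂+W₂) + C₁W₂`. [cite: BenfattoGiulianiMastropietro2006, §3 (3.2)] -/
theorem norm_comp_incr_deriv2_le (h₁ : ∀ x, ‖g₁ x‖ ≤ C₁) (h₂ : ∀ x, ‖g₂ x‖ ≤ C₂) (i₁ : ∀ x y, ‖g₁ (x + y) - g₁ x‖ ≤ C₂ * |y|)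
    (i₂ : ∀ x y, ‖g₂ (x + y) - g₂ x‖ ≤ C₃ * |y|)
    {x y a b a' b' : ℝ} {D₁ D₂ W₀ W₁ W₂ : ℝ} (ha : |a| ≤ D₁) (hb : |b| ≤ D₂) (hy : |y| ≤ W₀) (ha' : |a'| ≤ W₁) (hb' : |b'| ≤ W₂) :
    ‖(g₂ (x + y) * ((a + a' : ℝ) : ℂ) ^ 2 + g₁ (x + y) * ((b + b' : ℝ) : ℂ)) - (g₂ x * (a : ℂ) ^ 2 + g₁ x * (b : ℂ))‖ ≤
      C₃ * W₀ * (D₁ + W₁) ^ 2 + C₂ * (W₁ * (2 * D₁ + W₁)) + (C₂ * W₀ * (D₂ + W₂) + C₁ * W₂) := by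
  have hC₁ : 0 ≤ C₁ := (norm_nonneg _).trans (h₁ 0)
  have hC₂ : 0 ≤ C₂ := (norm_nonneg _).trans (h₂ 0)
  have hC₃ : 0 ≤ C₃ := by
    have h := i₂ 0 1
    have : (0 : ℝ) ≤ C₃ * |(1:ℝ)| := (norm_nonneg _).trans h
    simpa using this
  have hD1 : 0 ≤ D₁ := (abs_nonneg _).trans ha
  have hW0 : 0 ≤ W₀ := (abs_nonneg _).trans hy
  have hW1 : 0 ≤ W₁ := (abs_nonneg _).trans ha'
  have key : (g₂ (x + y) * ((a + a' : ℝ) : ℂ) ^ 2 + g₁ (x + y) * ((b + b' : ℝ) : ℂ)) - (g₂ x * (a : ℂ) ^ 2 + g₁ x * (b : ℂ)) =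
      ((g₂ (x + y) - g₂ x) * ((a + a' : ℝ) : ℂ) ^ 2 + g₂ x * (((a + a' : ℝ) : ℂ) ^ 2 - (a : ℂ) ^ 2)) +
        ((g₁ (x + y) - g₁ x) * ((b + b' : ℝ) : ℂ) + g₁ x * ((b' : ℝ) : ℂ)) := by push_cast; ring
  rw [key]
  have nA : ‖((a + a' : ℝ) : ℂ)‖ ≤ D₁ + W₁ := by
    rw [Complex.norm_real, Real.norm_eq_abs]; exact (abs_add_le _ _).trans (add_le_add ha ha')
  have t1 : ‖(g₂ (x + y) - g₂ x) * ((a + a' : ℝ) : ℂ) ^ 2‖ ≤ C₃ * W₀ * (D₁ + W₁) ^ 2 := by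
    rw [norm_mul, norm_pow]
    exact mul_le_mul ((i₂ x y).trans (mul_le_mul_of_nonneg_left hy hC₃)) (pow_le_pow_left₀ (norm_nonneg _) nA 2) (by positivity)
      (by positivity)
  have t2 : ‖g₂ x * (((a + a' : ℝ) : ℂ) ^ 2 - (a : ℂ) ^ 2)‖ ≤ C₂ * (W₁ * (2 * D₁ + W₁)) := by
    rw [norm_mul, show (((a + a' : ℝ) : ℂ) ^ 2 - (a : ℂ) ^ 2) = (((a + a') ^ 2 - a ^ 2 : ℝ) : ℂ) by push_cast; ring,
      Complex.norm_real, Real.norm_eq_abs]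
    have hsq : |(a + a') ^ 2 - a ^ 2| ≤ |a'| * (2 * |a| + |a'|) := by
      rw [show (a + a') ^ 2 - a ^ 2 = a' * (2 * a + a') by ring, abs_mul]
      refine mul_le_mul_of_nonneg_left ((abs_add_le _ _).trans ?_) (abs_nonneg _)
      rw [abs_mul, abs_of_pos (by norm_num : (0:ℝ) < 2)]
    refine mul_le_mul (h₂ x) (hsq.trans ?_) (abs_nonneg _) hC₂
    exact mul_le_mul ha' (by linarith) (by positivity) hW1
  have t3 : ‖(g₁ (x + y) - g₁ x) * ((b + b' : ℝ) : ℂ)‖ ≤ C₂ * W₀ * (D₂ + W₂) := by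
    rw [norm_mul, Complex.norm_real, Real.norm_eq_abs]
    exact mul_le_mul ((i₁ x y).trans (mul_le_mul_of_nonneg_left hy hC₂)) ((abs_add_le _ _).trans (add_le_add hb hb')) (abs_nonneg _)
      (by positivity)
  have t4 : ‖g₁ x * ((b' : ℝ) : ℂ)‖ ≤ C₁ * W₂ := by
    rw [norm_mul, Complex.norm_real, Real.norm_eq_abs]
    exact mul_le_mul (h₁ x) hb' (abs_nonneg _) hC₁
  exact (norm_add_le _ _).trans (add_le_add ((norm_add_le _ _).trans (add_le_add t1 t2)) ((norm_add_le _ _).trans (add_le_add t3 t4)))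

/-- **Order three**: the third member of the increment chain is at most
`C₄W₀(D₁+W₁)³ + C₃W₁(3D₁²+3D₁W₁+W₁²) + 3(C₃W₀(D₁+W₁)(D₂+W₂) + C₂(D₁W₂+W₁D₂+W₁W₂)) + C₂W₀(D₃+W₃) + C₁W₃`
(`|a| ≤ D₁, |b| ≤ D₂, |d| ≤ D₃`, `|y| ≤ W₀, |a′| ≤ W₁, |b′| ≤ W₂, |d′| ≤ W₃`). [cite: BenfattoGiulianiMastropietro2006, §3 (3.2)] -/
theorem norm_comp_incr_deriv3_le (h₁ : ∀ x, ‖g₁ x‖ ≤ C₁) (h₂ : ∀ x, ‖g₂ x‖ ≤ C₂) (h₃ : ∀ x, ‖g₃ x‖ ≤ C₃)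
    (i₁ : ∀ x y, ‖g₁ (x + y) - g₁ x‖ ≤ C₂ * |y|) (i₂ : ∀ x y, ‖g₂ (x + y) - g₂ x‖ ≤ C₃ * |y|)
    (i₃ : ∀ x y, ‖g₃ (x + y) - g₃ x‖ ≤ C₄ * |y|)
    {x y a b d a' b' d' : ℝ} {D₁ D₂ D₃ W₀ W₁ W₂ W₃ : ℝ}
    (ha : |a| ≤ D₁) (hb : |b| ≤ D₂) (hd : |d| ≤ D₃) (hy : |y| ≤ W₀) (ha' : |a'| ≤ W₁) (hb' : |b'| ≤ W₂) (hd' : |d'| ≤ W₃) :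
    ‖(g₃ (x + y) * ((a + a' : ℝ) : ℂ) ^ 3 + 3 * (g₂ (x + y) * ((a + a' : ℝ) : ℂ) * ((b + b' : ℝ) : ℂ)) + g₁ (x + y) * ((d + d' : ℝ) : ℂ)) -
      (g₃ x * (a : ℂ) ^ 3 + 3 * (g₂ x * (a : ℂ) * (b : ℂ)) + g₁ x * (d : ℂ))‖ ≤
      C₄ * W₀ * (D₁ + W₁) ^ 3 + C₃ * (W₁ * (3 * D₁ ^ 2 + 3 * D₁ * W₁ + W₁ ^ 2)) +
        3 * (C₃ * W₀ * ((D₁ + W₁) * (D₂ + W₂)) + C₂ * (D₁ * W₂ + W₁ * D₂ + W₁ * W₂)) + (C₂ * W₀ * (D₃ + W₃) + C₁ * W₃) := by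
  have hC₁ : 0 ≤ C₁ := (norm_nonneg _).trans (h₁ 0)
  have hC₂ : 0 ≤ C₂ := (norm_nonneg _).trans (h₂ 0)
  have hC₃ : 0 ≤ C₃ := (norm_nonneg _).trans (h₃ 0)
  have hC₄ : 0 ≤ C₄ := by
    have h := i₃ 0 1
    have : (0 : ℝ) ≤ C₄ * |(1:ℝ)| := (norm_nonneg _).trans h
    simpa using this
  have hD1 : 0 ≤ D₁ := (abs_nonneg _).trans ha
  have hD2 : 0 ≤ D₂ := (abs_nonneg _).trans hb
  have hD3 : 0 ≤ D₃ := (abs_nonneg _).trans hd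
  have hW0 : 0 ≤ W₀ := (abs_nonneg _).trans hy
  have hW1 : 0 ≤ W₁ := (abs_nonneg _).trans ha'
  have hW2 : 0 ≤ W₂ := (abs_nonneg _).trans hb'
  have hW3 : 0 ≤ W₃ := (abs_nonneg _).trans hd'
  have h := norm_chain3_three_sub_le (g₁ := g₁) (g₂ := g₂) (g₃ := g₃) (C₁ := C₁) (C₂ := C₂) (C₃ := C₃) (C₄ := C₄)
    h₁ h₂ h₃ i₁ i₂ i₃ x y a b d a' b' d'
  refine h.trans ?_
  have s1 : |a| + |a'| ≤ D₁ + W₁ := add_le_add ha ha'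
  have s1' : 0 ≤ |a| + |a'| := by positivity
  have e1 : C₄ * |y| * (|a| + |a'|) ^ 3 ≤ C₄ * W₀ * (D₁ + W₁) ^ 3 :=
    mul_le_mul (mul_le_mul_of_nonneg_left hy hC₄) (pow_le_pow_left₀ s1' s1 3) (by positivity) (by positivity)
  have hcube : |(a + a') ^ 3 - a ^ 3| ≤ |a'| * (3 * |a| ^ 2 + 3 * |a| * |a'| + |a'| ^ 2) := by
    rw [show (a + a') ^ 3 - a ^ 3 = a' * (3 * a ^ 2 + 3 * a * a' + a' ^ 2) by ring, abs_mul]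
    refine mul_le_mul_of_nonneg_left ?_ (abs_nonneg _)
    calc |3 * a ^ 2 + 3 * a * a' + a' ^ 2| ≤ |3 * a ^ 2 + 3 * a * a'| + |a' ^ 2| := abs_add_le _ _
      _ ≤ (|3 * a ^ 2| + |3 * a * a'|) + |a' ^ 2| := add_le_add (abs_add_le _ _) le_rfl
      _ = 3 * |a| ^ 2 + 3 * |a| * |a'| + |a'| ^ 2 := by
          rw [abs_mul, abs_mul, abs_mul, abs_pow, abs_pow, abs_of_pos (by norm_num : (0:ℝ) < 3)]
  have hprod : |(a + a') * (b + b') - a * b| ≤ |a| * |b'| + |a'| * |b| + |a'| * |b'| := by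
    rw [show (a + a') * (b + b') - a * b = a * b' + a' * b + a' * b' by ring]
    calc _ ≤ |a * b' + a' * b| + |a' * b'| := abs_add_le _ _
      _ ≤ (|a * b'| + |a' * b|) + |a' * b'| := add_le_add (abs_add_le _ _) le_rfl
      _ = _ := by rw [abs_mul, abs_mul, abs_mul]
  have e2 : C₃ * |(a + a') ^ 3 - a ^ 3| ≤ C₃ * (W₁ * (3 * D₁ ^ 2 + 3 * D₁ * W₁ + W₁ ^ 2)) := by
    refine mul_le_mul_of_nonneg_left (hcube.trans ?_) hC₃
    refine mul_le_mul ha' ?_ (by positivity) hW1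
    nlinarith [mul_le_mul ha ha (abs_nonneg a) hD1, mul_le_mul ha ha' (abs_nonneg a') hD1, mul_le_mul ha' ha' (abs_nonneg a') hW1,
      abs_nonneg a, abs_nonneg a']
  have e3 : C₃ * |y| * ((|a| + |a'|) * (|b| + |b'|)) ≤ C₃ * W₀ * ((D₁ + W₁) * (D₂ + W₂)) :=
    mul_le_mul (mul_le_mul_of_nonneg_left hy hC₃) (mul_le_mul s1 (add_le_add hb hb') (by positivity) (by positivity))
      (by positivity) (by positivity)
  have e4 : C₂ * |(a + a') * (b + b') - a * b| ≤ C₂ * (D₁ * W₂ + W₁ * D₂ + W₁ * W₂) := by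
    refine mul_le_mul_of_nonneg_left (hprod.trans ?_) hC₂
    exact add_le_add (add_le_add (mul_le_mul ha hb' (abs_nonneg _) hD1) (mul_le_mul ha' hb (abs_nonneg _) hW1))
      (mul_le_mul ha' hb' (abs_nonneg _) hW1)
  have e5 : C₂ * |y| * (|d| + |d'|) ≤ C₂ * W₀ * (D₃ + W₃) :=
    mul_le_mul (mul_le_mul_of_nonneg_left hy hC₂) (add_le_add hd hd') (by positivity) (by positivity)
  have e6 : C₁ * |d'| ≤ C₁ * W₃ := mul_le_mul_of_nonneg_left hd' hC₁
  have e34 : 3 * (C₃ * |y| * ((|a| + |a'|) * (|b| + |b'|)) + C₂ * |(a + a') * (b + b') - a * b|) ≤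
      3 * (C₃ * W₀ * ((D₁ + W₁) * (D₂ + W₂)) + C₂ * (D₁ * W₂ + W₁ * D₂ + W₁ * W₂)) :=
    mul_le_mul_of_nonneg_left (add_le_add e3 e4) (by norm_num)
  linarith

/-! ### §3 Forward differences of the increment along the line -/

/-- **Zeroth order along the line**: `‖g(u t + w t) − g(u t)‖ ≤ C₁W₀` (`|w| ≤ W₀`). [cite: BenfattoGiulianiMastropietro2006, §3 (3.2)] -/
theorem norm_comp_incr_line_le (i₀ : ∀ x y, ‖g (x + y) - g x‖ ≤ C₁ * |y|) {u w : ℝ → ℝ} {W₀ : ℝ} (hW₀ : ∀ t, |w t| ≤ W₀) (t : ℝ) :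
    ‖g (u t + w t) - g (u t)‖ ≤ C₁ * W₀ :=
  norm_comp_incr_le i₀ (hW₀ t)

/-- **First difference of the increment along the line**: with `|u₁| ≤ D₁`, `|w| ≤ W₀`, `|w₁| ≤ W₁` everywhere and `δ ≥ 0`,
`‖Δ_δ(g∘(u+w) − g∘u)(t)‖ ≤ δ·(C₂W₀(D₁+W₁) + C₁W₁)`. [cite: BenfattoGiulianiMastropietro2006, §3 (3.2)] -/
theorem norm_fwdDiff_comp_incr_le (hg : ∀ x, HasDerivAt g (g₁ x) x) (h₁ : ∀ x, ‖g₁ x‖ ≤ C₁) (i₁ : ∀ x y, ‖g₁ (x + y) - g₁ x‖ ≤ C₂ * |y|)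
    {u u₁ w w₁ : ℝ → ℝ} (hu : ∀ t, HasDerivAt u (u₁ t) t) (hw : ∀ t, HasDerivAt w (w₁ t) t)
    {D₁ W₀ W₁ : ℝ} (hD₁ : ∀ t, |u₁ t| ≤ D₁) (hW₀ : ∀ t, |w t| ≤ W₀) (hW₁ : ∀ t, |w₁ t| ≤ W₁) {δ : ℝ} (hδ : 0 ≤ δ) (t : ℝ) :
    ‖fwdDiff δ (fun s => g (u s + w s) - g (u s)) t‖ ≤ δ * (C₂ * W₀ * (D₁ + W₁) + C₁ * W₁) := by
  have hcomp : ∀ {v v₁ : ℝ → ℝ}, (∀ s, HasDerivAt v (v₁ s) s) → ∀ s, HasDerivAt (fun s => g (v s)) (g₁ (v s) * (v₁ s : ℂ)) s := by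
    intro v v₁ hv s
    have h := (hg (v s)).scomp s (hv s)
    have e : (v₁ s) • g₁ (v s) = g₁ (v s) * (v₁ s : ℂ) := by rw [Complex.real_smul, mul_comm]
    rw [e] at h; exact h
  have hderiv : ∀ s, HasDerivAt (fun s => g (u s + w s) - g (u s)) (g₁ (u s + w s) * ((u₁ s + w₁ s : ℝ) : ℂ) - g₁ (u s) * (u₁ s : ℂ)) s :=
    fun s => (hcomp (v := fun s => u s + w s) (v₁ := fun s => u₁ s + w₁ s) (fun s => (hu s).add (hw s)) s).sub (hcomp hu s)
  set G : ℕ → ℝ → ℂ := fun k s =>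
      if k = 0 then g (u s + w s) - g (u s)
      else if k = 1 then g₁ (u s + w s) * ((u₁ s + w₁ s : ℝ) : ℂ) - g₁ (u s) * (u₁ s : ℂ)
      else 0 with hG
  have h := Literature.Analysis.norm_fwdDiff_iter_le_of_hasDerivAt hδ 1 G t (C₂ * W₀ * (D₁ + W₁) + C₁ * W₁)
    (fun k hk s _ => by
      interval_cases k
      show HasDerivAt (fun s => g (u s + w s) - g (u s)) (g₁ (u s + w s) * ((u₁ s + w₁ s : ℝ) : ℂ) - g₁ (u s) * (u₁ s : ℂ)) s
      exact hderiv s)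
    (fun s _ => by
      show ‖G 1 s‖ ≤ _
      have : G 1 s = g₁ (u s + w s) * ((u₁ s + w₁ s : ℝ) : ℂ) - g₁ (u s) * (u₁ s : ℂ) := by simp [hG]
      rw [this]
      exact norm_comp_incr_deriv1_le h₁ i₁ (hD₁ s) (hW₀ s) (hW₁ s))
  have h0 : G 0 = fun s => g (u s + w s) - g (u s) := by funext s; simp [hG]
  rw [h0, Function.iterate_one, pow_one] at h
  exact h

/-- **Second difference of the increment along the line**: with `|u₁| ≤ D₁`, `|u₂| ≤ D₂`, `|w| ≤ W₀`, `|w₁| ≤ W₁`, `|w₂| ≤ W₂` everywhere and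
`δ ≥ 0`, `‖Δ_δ²(g∘(u+w) − g∘u)(t)‖ ≤ δ²·(C₃W₀(D₁+W₁)² + C₂W₁(2D₁+W₁) + C₂W₀(D₂+W₂) + C₁W₂)`. [cite: BenfattoGiulianiMastropietro2006, §3 (3.2)] -/
theorem norm_fwdDiff_iter_two_comp_incr_le (hg : ∀ x, HasDerivAt g (g₁ x) x) (hg₁ : ∀ x, HasDerivAt g₁ (g₂ x) x)
    (h₁ : ∀ x, ‖g₁ x‖ ≤ C₁) (h₂ : ∀ x, ‖g₂ x‖ ≤ C₂) (i₁ : ∀ x y, ‖g₁ (x + y) - g₁ x‖ ≤ C₂ * |y|)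
    (i₂ : ∀ x y, ‖g₂ (x + y) - g₂ x‖ ≤ C₃ * |y|)
    {u u₁ u₂ w w₁ w₂ : ℝ → ℝ} (hu : ∀ t, HasDerivAt u (u₁ t) t) (hu₁ : ∀ t, HasDerivAt u₁ (u₂ t) t)
    (hw : ∀ t, HasDerivAt w (w₁ t) t) (hw₁ : ∀ t, HasDerivAt w₁ (w₂ t) t)
    {D₁ D₂ W₀ W₁ W₂ : ℝ} (hD₁ : ∀ t, |u₁ t| ≤ D₁) (hD₂ : ∀ t, |u₂ t| ≤ D₂) (hW₀ : ∀ t, |w t| ≤ W₀) (hW₁ : ∀ t, |w₁ t| ≤ W₁)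
    (hW₂ : ∀ t, |w₂ t| ≤ W₂) {δ : ℝ} (hδ : 0 ≤ δ) (t : ℝ) :
    ‖(fwdDiff δ)^[2] (fun s => g (u s + w s) - g (u s)) t‖ ≤
      δ ^ 2 * (C₃ * W₀ * (D₁ + W₁) ^ 2 + C₂ * (W₁ * (2 * D₁ + W₁)) + (C₂ * W₀ * (D₂ + W₂) + C₁ * W₂)) := by
  have hcomp : ∀ {f f' : ℝ → ℂ} {v v₁ : ℝ → ℝ}, (∀ x, HasDerivAt f (f' x) x) → (∀ s, HasDerivAt v (v₁ s) s) →
      ∀ s, HasDerivAt (fun s => f (v s)) (f' (v s) * (v₁ s : ℂ)) s := by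
    intro f f' v v₁ hf hv s
    have h := (hf (v s)).scomp s (hv s)
    have e : (v₁ s) • f' (v s) = f' (v s) * (v₁ s : ℂ) := by rw [Complex.real_smul, mul_comm]
    rw [e] at h; exact h
  have hc' : ∀ {v v' : ℝ → ℝ}, (∀ s, HasDerivAt v (v' s) s) → ∀ s, HasDerivAt (fun s => (v s : ℂ)) ((v' s : ℂ)) s :=
    fun h s => HasDerivAt.ofReal_comp (h s)
  set G : ℕ → ℝ → ℂ := fun k s =>
      if k = 0 then g (u s + w s) - g (u s)
      else if k = 1 then g₁ (u s + w s) * ((u₁ s + w₁ s : ℝ) : ℂ) - g₁ (u s) * (u₁ s : ℂ)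
      else if k = 2 then (g₂ (u s + w s) * ((u₁ s + w₁ s : ℝ) : ℂ) ^ 2 + g₁ (u s + w s) * ((u₂ s + w₂ s : ℝ) : ℂ)) -
        (g₂ (u s) * (u₁ s : ℂ) ^ 2 + g₁ (u s) * (u₂ s : ℂ))
      else 0 with hG
  have hv : ∀ s, HasDerivAt (fun s => u s + w s) (u₁ s + w₁ s) s := fun s => (hu s).add (hw s)
  have hv₁ : ∀ s, HasDerivAt (fun s => u₁ s + w₁ s) (u₂ s + w₂ s) s := fun s => (hu₁ s).add (hw₁ s)
  have hchain : ∀ k < 2, ∀ s, HasDerivAt (G k) (G (k + 1) s) s := by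
    intro k hk s
    interval_cases k
    · show HasDerivAt (fun s => g (u s + w s) - g (u s)) (g₁ (u s + w s) * ((u₁ s + w₁ s : ℝ) : ℂ) - g₁ (u s) * (u₁ s : ℂ)) s
      exact (hcomp hg hv s).sub (hcomp hg hu s)
    · show HasDerivAt (fun s => g₁ (u s + w s) * ((u₁ s + w₁ s : ℝ) : ℂ) - g₁ (u s) * (u₁ s : ℂ))
        ((g₂ (u s + w s) * ((u₁ s + w₁ s : ℝ) : ℂ) ^ 2 + g₁ (u s + w s) * ((u₂ s + w₂ s : ℝ) : ℂ)) -
          (g₂ (u s) * (u₁ s : ℂ) ^ 2 + g₁ (u s) * (u₂ s : ℂ))) s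
      have hA := ((hcomp hg₁ hv s).mul (hc' hv₁ s))
      have hB := ((hcomp hg₁ hu s).mul (hc' hu₁ s))
      refine (hA.sub hB).congr_deriv ?_
      push_cast
      ring
  have h := Literature.Analysis.norm_fwdDiff_iter_le_of_hasDerivAt hδ 2 G t
    (C₃ * W₀ * (D₁ + W₁) ^ 2 + C₂ * (W₁ * (2 * D₁ + W₁)) + (C₂ * W₀ * (D₂ + W₂) + C₁ * W₂))
    (fun k hk s _ => hchain k hk s)
    (fun s _ => by
      show ‖G 2 s‖ ≤ _
      have : G 2 s = (g₂ (u s + w s) * ((u₁ s + w₁ s : ℝ) : ℂ) ^ 2 + g₁ (u s + w s) * ((u₂ s + w₂ s : ℝ) : ℂ)) -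
          (g₂ (u s) * (u₁ s : ℂ) ^ 2 + g₁ (u s) * (u₂ s : ℂ)) := by simp [hG]
      rw [this]
      exact norm_comp_incr_deriv2_le h₁ h₂ i₁ i₂ (hD₁ s) (hD₂ s) (hW₀ s) (hW₁ s) (hW₂ s))
  have h0 : G 0 = fun s => g (u s + w s) - g (u s) := by funext s; simp [hG]
  rw [h0] at h
  exact h

/-- **Third difference of the increment along the line**: under the pointwise data `|u_i| ≤ D_i`, `|w| ≤ W₀`, `|w_i| ≤ W_i` everywhere, for
`δ ≥ 0`, `‖Δ_δ³(g∘(u+w) − g∘u)(t)‖ ≤ δ³ · [the bound of norm_comp_incr_deriv3_le]`. [cite: BenfattoGiulianiMastropietro2006, §3 (3.2)] -/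
theorem norm_fwdDiff_iter_three_comp_incr_le (hg : ∀ x, HasDerivAt g (g₁ x) x) (hg₁ : ∀ x, HasDerivAt g₁ (g₂ x) x)
    (hg₂ : ∀ x, HasDerivAt g₂ (g₃ x) x) (h₁ : ∀ x, ‖g₁ x‖ ≤ C₁) (h₂ : ∀ x, ‖g₂ x‖ ≤ C₂) (h₃ : ∀ x, ‖g₃ x‖ ≤ C₃)
    (i₁ : ∀ x y, ‖g₁ (x + y) - g₁ x‖ ≤ C₂ * |y|) (i₂ : ∀ x y, ‖g₂ (x + y) - g₂ x‖ ≤ C₃ * |y|)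
    (i₃ : ∀ x y, ‖g₃ (x + y) - g₃ x‖ ≤ C₄ * |y|)
    {u u₁ u₂ u₃ w w₁ w₂ w₃ : ℝ → ℝ}
    (hu : ∀ t, HasDerivAt u (u₁ t) t) (hu₁ : ∀ t, HasDerivAt u₁ (u₂ t) t) (hu₂ : ∀ t, HasDerivAt u₂ (u₃ t) t)
    (hw : ∀ t, HasDerivAt w (w₁ t) t) (hw₁ : ∀ t, HasDerivAt w₁ (w₂ t) t) (hw₂ : ∀ t, HasDerivAt w₂ (w₃ t) t)
    {D₁ D₂ D₃ W₀ W₁ W₂ W₃ : ℝ} (hD₁ : ∀ t, |u₁ t| ≤ D₁) (hD₂ : ∀ t, |u₂ t| ≤ D₂) (hD₃ : ∀ t, |u₃ t| ≤ D₃)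
    (hW₀ : ∀ t, |w t| ≤ W₀) (hW₁ : ∀ t, |w₁ t| ≤ W₁) (hW₂ : ∀ t, |w₂ t| ≤ W₂) (hW₃ : ∀ t, |w₃ t| ≤ W₃) {δ : ℝ} (hδ : 0 ≤ δ) (t : ℝ) :
    ‖(fwdDiff δ)^[3] (fun s => g (u s + w s) - g (u s)) t‖ ≤
      δ ^ 3 * (C₄ * W₀ * (D₁ + W₁) ^ 3 + C₃ * (W₁ * (3 * D₁ ^ 2 + 3 * D₁ * W₁ + W₁ ^ 2)) +
        3 * (C₃ * W₀ * ((D₁ + W₁) * (D₂ + W₂)) + C₂ * (D₁ * W₂ + W₁ * D₂ + W₁ * W₂)) + (C₂ * W₀ * (D₃ + W₃) + C₁ * W₃)) := by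
  set H : ℕ → ℝ → ℂ := fun k t =>
      if k = 0 then g (u t + w t) - g (u t)
      else if k = 1 then g₁ (u t + w t) * ((u₁ t + w₁ t : ℝ) : ℂ) - g₁ (u t) * (u₁ t : ℂ)
      else if k = 2 then (g₂ (u t + w t) * ((u₁ t + w₁ t : ℝ) : ℂ) ^ 2 + g₁ (u t + w t) * ((u₂ t + w₂ t : ℝ) : ℂ)) -
        (g₂ (u t) * (u₁ t : ℂ) ^ 2 + g₁ (u t) * (u₂ t : ℂ))
      else if k = 3 then (g₃ (u t + w t) * ((u₁ t + w₁ t : ℝ) : ℂ) ^ 3 + 3 * (g₂ (u t + w t) * ((u₁ t + w₁ t : ℝ) : ℂ) *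
          ((u₂ t + w₂ t : ℝ) : ℂ)) + g₁ (u t + w t) * ((u₃ t + w₃ t : ℝ) : ℂ)) -
        (g₃ (u t) * (u₁ t : ℂ) ^ 3 + 3 * (g₂ (u t) * (u₁ t : ℂ) * (u₂ t : ℂ)) + g₁ (u t) * (u₃ t : ℂ))
      else 0 with hH
  have hchain : ∀ k < 3, ∀ t, HasDerivAt (H k) (H (k + 1) t) t :=
    hasDerivAt_comp_incr_chain hg hg₁ hg₂ hu hu₁ hu₂ hw hw₁ hw₂
  set K : ℝ := C₄ * W₀ * (D₁ + W₁) ^ 3 + C₃ * (W₁ * (3 * D₁ ^ 2 + 3 * D₁ * W₁ + W₁ ^ 2)) +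
        3 * (C₃ * W₀ * ((D₁ + W₁) * (D₂ + W₂)) + C₂ * (D₁ * W₂ + W₁ * D₂ + W₁ * W₂)) + (C₂ * W₀ * (D₃ + W₃) + C₁ * W₃) with hK
  have hbound : ∀ s, ‖H 3 s‖ ≤ K := by
    intro s
    have h3 : H 3 s = (g₃ (u s + w s) * ((u₁ s + w₁ s : ℝ) : ℂ) ^ 3 + 3 * (g₂ (u s + w s) * ((u₁ s + w₁ s : ℝ) : ℂ) *
          ((u₂ s + w₂ s : ℝ) : ℂ)) + g₁ (u s + w s) * ((u₃ s + w₃ s : ℝ) : ℂ)) -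
        (g₃ (u s) * (u₁ s : ℂ) ^ 3 + 3 * (g₂ (u s) * (u₁ s : ℂ) * (u₂ s : ℂ)) + g₁ (u s) * (u₃ s : ℂ)) := by
      simp [hH]
    rw [h3]
    exact norm_comp_incr_deriv3_le h₁ h₂ h₃ i₁ i₂ i₃ (hD₁ s) (hD₂ s) (hD₃ s) (hW₀ s) (hW₁ s) (hW₂ s) (hW₃ s)
  have h := Literature.Analysis.norm_fwdDiff_iter_le_of_hasDerivAt hδ 3 H t K (fun k hk s _ => hchain k hk s) (fun s _ => hbound s)
  have h0 : H 0 = fun s => g (u s + w s) - g (u s) := by funext s; simp [hH]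
  rw [h0] at h
  exact h

end Chain

end Literature.Analysis.Calculus

end
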